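import Summits.ResolutionOfSingularities.ResolutionOfSingularities.Theorems.FrobeniusLadderFInjectiveMacaulayficationResolutionOfTr
import HarnessLib

/-!
# THE LOCAL-FULL RUNG `ClosedPointLocalResolutionFullTr p e r` (T_FULL): T restricted to CLOSED points with FULL local ring — and why it closes
# (crux `FInjectiveMacaulayfication` stmt-ResolutionOfSingularities-15315, chain w45a; res-L1-w45a-plan-1 RULING R18.5 (3) «local-FULL door, NOT APPROVED pending
# stub-3's verdict»; MEMO v2 §R1″ of res-L1-w45a-stub-3 g9: THERE IS A CLOSING ENGINE — Temkin's own Noetherian induction; object O4b over `ResolutionOfTr` p615457)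

[OURS · L1 W4.5a] Support file (`--supports stmt-ResolutionOfSingularities-15315 --as helper`); replaces the role of NO printed item; NOT a statement of any
manuscript; ONE definition (`@[conjecture] def ClosedPointLocalResolutionFullTr`, OURS candidate, consumed only as a hypothesis; no instance, no notation, no
named fact) and theorems CONDITIONAL on printed theorems BY NAME and on the chain's CANDIDATE statements. AI-written (AI review is weaker than expert review).

WHAT. `T_FULL(p,e,r)` := `ClosedPointLocalResolutionAdmTr p e r` with ONE extra hypothesis — the local ring `𝒪_{Y,y}` at the closed point is FULL (`SliceableCentre.FullCl p`:
domain ∧ Cohen–Macaulay ∧ parameter ideals Frobenius-closed). It is implied by T (restriction) and implies `ResolutionFullTr` (§3), so modulo the prints and the F-half the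
FOUR families {T}, {ResolutionTr}, {FullBlowupTr ∧ ResolutionFullTr}, {T_FULL} are EQUIVALENT level by level (p612760, p613542, p615457, this file). THE ENGINE
(answer to R18.5 (3)): Temkin's Prop. 2.3.4 (iii)⇒(ii) run on the FULL variety `Y` itself — Noetherian induction on closed subsets (`DesingularizationOffClosedPointsAdm`
for the non-closed points, `ResolutionOfTr.admitsDesingularization_of_regularOffFinite_of_localRes` for the closed ones) — consumes condition (iii) only at points of
`Y`, whose germs are all FULL; NO patching and NO alternation with the F-half occur.
* §1 `ClosedPointLocalResolutionFullTr`, `trFull_of_tr`, `trFull_mono` (res-L1-w45a-lead-1's tower isomorphism), `forall_trFull_of_one`.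
* §2 `localBody_at_nonClosed_of_trFull` / `hlocAdm_of_cp_of_trFull` — the (LR_adm) body at NON-closed points of a FULL variety from T_FULL at the levels below (the
  closed-point chart `exists_closedPoint_model_pos` + `NonClosedPointChart.localBody_of_iso` + FULL along the stalk isomorphism; levels ≤ 3 by the dim-3
  specialisation trick and Cossart–Piltant).
* §3 ★★ `resolutionFullTr_of_trFull (h4 : 4 ≤ e) (hG h081R hP) (hTFlt : ∀ e′ j, 4 ≤ e′ → e′ + 1 ≤ e → 1 ≤ j → T_FULL p e′ j) (hTF : T_FULL p e r) : ResolutionFullTr p e r`.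
* §4 door terms: ★★★ `fInjectiveMacaulayfication_of_prints_of_LFadmF_of_trFullOne (hG h081R hP hM) (hLF) (hTF1 : ∀ p e, p.Prime → 4 ≤ e → T_FULL p e 1) :
  Theses.FrobeniusLadder.FInjectiveMacaulayfication` — «crux ⟸ four prints ∧ F-half ∧ {at a CLOSED point with F-injective Cohen–Macaulay (FULL) local ring of an e-fold over
  k(s), e ≥ 4, every admissible blowing up of the germ regular off the closed fibre admits a desingularization}»; and `tr_of_prints_of_F_of_trFull` (T(p,e,r) back from
  T_FULL(≤ e) ∧ F(4..e) ∧ prints: the equivalence web).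
HONEST CAVEATS: T_FULL is weaker than T and than ResolutionFullTr only IN LETTER — all four are equivalent modulo prints ∧ F-half; it is open for every e ≥ 4; FULL ⊋
F-rational (not rung 15317). Whether a «local-FULL door» is registered is res-L1-w45a-plan-1's call; this file only supplies the kernel facts.
[folklore assembly; cite: Temkin2008, §2.1, Lemma 2.1.1, Lemma 2.1.4, Def. 2.2.6, Prop. 2.3.4] [cite: StacksProject, Tag 080B; Tag 01J7] [cite: CossartPiltant2019, Thm. 1.1 (i)(ii); Prop. 4.4]
[cite: Cesnavicius2021, Thm. 5.3] [cite: RaynaudGruson1971, Thm. 5.2.2] [cite: EGAIV2, §6; Matsumura1987, §33 Lemma 2]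
-/

-- single-problem summit: the doubled namespace component is forced
set_option linter.dupNamespace false

noncomputable section

namespace Summit.ResolutionOfSingularities.ResolutionOfSingularities.Theorems.FInjectiveMacaulayfication.TrFull

open CategoryTheory CategoryTheory.Limits AlgebraicGeometry TopologicalSpace IsLocalRing Order
open Literature.AlgebraicGeometry.Resolution
open Summit.ResolutionOfSingularities.ResolutionOfSingularities.Theorems.FInjectiveMacaulayfication
open SliceableCentre ClosedPointLocalResolutionAdmTr TrOfResolution TrOfResolutionFull ResolutionOfTr

/-! ## §1 The local-FULL rung -/

/-- [OURS · CANDIDATE statement] **`ClosedPointLocalResolutionFullTr p e r` (T_FULL) — CLOSED-POINT ADMISSIBLE LOCAL RESOLUTION OF FULL GERMS OF `e`-FOLDS OVER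
`k(X₁,…,X_r)`.** `ClosedPointLocalResolutionAdmTr p e r` verbatim with ONE extra hypothesis after the closed point: `FullCl p (Y.presheaf.stalk y)` — the local ring at `y`
is a domain, Cohen–Macaulay, with Frobenius-closed parameter ideals (F-injective CM). For every field `k` of characteristic `p`, `K := FractionRing (MvPolynomial (Fin r) k)`,
every integral separated finite-type `e`-fold `Y/K`, every CLOSED `y` with FULL `𝒪_{Y,y}`: every ADMISSIBLE blowing up `S′ → Spec 𝒪_{Y,y}` whose singular points lie on
the closed fibre admits a desingularization. Consumed only as a hypothesis. [candidate statement, OURS; cite: Temkin2008, Prop. 2.3.4 (iii); Def. 2.2.6] -/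
@[conjecture] def ClosedPointLocalResolutionFullTr (p e r : ℕ) : Prop :=
  ∀ (k : Type) [Field k] [CharP k p] (Y : Scheme.{0}) (g : Y ⟶ Spec (.of (FractionRing (MvPolynomial (Fin r) k)))),
    IsSeparated g → LocallyOfFiniteType g → QuasiCompact g → IsIntegral Y → topologicalKrullDim Y = e →
    ∀ y : Y, IsClosed ({y} : Set Y) → FullCl p (Y.presheaf.stalk y) →
      ∀ (S' : Scheme.{0}) (g' : S' ⟶ Spec (Y.presheaf.stalk y)) (I : (Spec (Y.presheaf.stalk y)).IdealSheafData),
        IsBlowup g' I → ((I.support : Set _) ⊆ (Scheme.regularLocus (Spec (Y.presheaf.stalk y)))ᶜ) →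
        (∀ s : S', s ∉ Scheme.regularLocus S' → g'.base s = closedPoint (Y.presheaf.stalk y)) →
        Scheme.AdmitsDesingularization S'

/-- T ⇒ T_FULL (forget the extra hypothesis). [plumbing] -/
theorem trFull_of_tr {p e r : ℕ} (h : ClosedPointLocalResolutionAdmTr p e r) : ClosedPointLocalResolutionFullTr p e r :=
  fun k _ _ Y g hs hl hq hi hd y hy _ S' g' I hg' hI hfib => h k Y g hs hl hq hi hd y hy S' g' I hg' hI hfib

/-- **Transcendence monotonicity of T_FULL** (as `ClosedPointLocalResolutionAdmTrMono.closedPointLocalResolutionAdmTr_mono`: an `e`-fold over `k(s₁,…,s_{j+r})` is one over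
`k′(s₁,…,s_j)`, `k′ = k(t₁,…,t_r)`, along `Spec` of res-L1-w45a-lead-1's tower isomorphism; every other binder lives on `Y`). [folklore] -/
theorem trFull_mono {p e j : ℕ} (h : ClosedPointLocalResolutionFullTr p e j) (r : ℕ) : ClosedPointLocalResolutionFullTr p e (j + r) := by
  intro k _ _ Y g hs hl hq hi hd y hy hfull S' g' I hg' hI hfib
  obtain ⟨φ⟩ := ClosedPointLocalResolutionAdmTrMono.nonempty_ringEquiv_fractionRing_tower k j r
  haveI := NonClosedPointChart.charP_fractionRing_mvPolynomial p k r
  let ι : Spec (.of (FractionRing (MvPolynomial (Fin (j + r)) k))) ⟶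
      Spec (.of (FractionRing (MvPolynomial (Fin j) (FractionRing (MvPolynomial (Fin r) k))))) :=
    Spec.map φ.toCommRingCatIso.hom
  haveI : IsIso ι := inferInstance
  haveI := hs; haveI := hl; haveI := hq
  exact h (FractionRing (MvPolynomial (Fin r) k)) Y (g ≫ ι) inferInstance inferInstance inferInstance hi hd y hy hfull S' g' I hg' hI hfib

/-- `r = 1` carries T_FULL at all `r ≥ 1`. [folklore] -/
theorem forall_trFull_of_one {p e : ℕ} (h : ClosedPointLocalResolutionFullTr p e 1) :
    ∀ r : ℕ, 1 ≤ r → ClosedPointLocalResolutionFullTr p e r := by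
  intro r hr
  obtain ⟨r₀, rfl⟩ := Nat.exists_eq_add_of_le hr
  exact trFull_mono h r₀

/-! ## §2 T_FULL at the closed-point models of NON-closed points of a FULL variety -/

/-- **The (LR_adm) body at a NON-CLOSED point `x` with FULL local ring of local dimension `e`** from `T_FULL(p,e,r)` for all `r ≥ 1`: `x` is a closed point of an `e`-fold
over `k(X₁,…,X_r)`, `r ≥ 1`, with isomorphic — hence FULL — local ring (`exists_closedPoint_model_pos`, `WFixAtNonClosedDimTwo.fullCl_of_ringEquiv`,
`NonClosedPointChart.localBody_of_iso`). [OURS · reduction; folklore; cite: EGAIV2, §6] -/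
theorem localBody_at_nonClosed_of_trFull (p : ℕ) {k : Type} [Field k] [CharP k p] {X : Scheme.{0}} (f : X ⟶ Spec (.of k))
    [LocallyOfFiniteType f] [IsIntegral X] (x : X) (hx : ¬ IsClosed ({x} : Set X)) (hxfull : FullCl p (X.presheaf.stalk x))
    {e : ℕ} (he : ringKrullDim (X.presheaf.stalk x) = e) (h : ∀ r : ℕ, 1 ≤ r → ClosedPointLocalResolutionFullTr p e r) :
    ∀ (S' : Scheme.{0}) (g : S' ⟶ Spec (X.presheaf.stalk x)) (I : (Spec (X.presheaf.stalk x)).IdealSheafData),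
      IsBlowup g I → ((I.support : Set _) ⊆ (Scheme.regularLocus (Spec (X.presheaf.stalk x)))ᶜ) →
      (∀ s : S', s ∉ Scheme.regularLocus S' → g.base s = closedPoint (X.presheaf.stalk x)) →
      Scheme.AdmitsDesingularization S' := by
  obtain ⟨r, Y, gY, y, _, hint, hsep, hft, hqc, hycl, ⟨ε⟩, hdimY, hxr⟩ := exists_closedPoint_model_pos p f x
  have hr : 1 ≤ r := by
    rcases hxr with hcl | hr
    · exact absurd hcl hx
    · exact hr
  have hdimY' : topologicalKrullDim Y = e := by rw [hdimY, he]
  have hyfull : FullCl p (Y.presheaf.stalk y) := WFixAtNonClosedDimTwo.fullCl_of_ringEquiv p ε.commRingCatIsoToRingEquiv hxfull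
  exact NonClosedPointChart.localBody_of_iso ε (h r hr k Y gY hsep hft hqc hint hdimY' y hycl hyfull)

/-- **(hloc) of `DesingularizationOffClosedPointsAdm.desingularization_offFinite_of_local_adm` for ONE FULL variety `X` of dimension `n ≥ 3`** from Cossart–Piltant below local
dimension 4 and `T_FULL(p,e,j)`, `4 ≤ e ≤ n − 1`, `j ≥ 1` (as `DimSlice.hlocAdm_of_cp_of_rungs`, with FULL germs). [OURS · conditional-result]
[cite: CossartPiltant2019, Thm. 1.1 (i)(ii); Prop. 4.4] -/
theorem hlocAdm_of_cp_of_trFull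
    (hG : CossartPiltant2019General.{0}) (h081R : Stacks081R.{0}) (hP : CossartPiltant2019Principalization.{0})
    (p : ℕ) (k : Type) [Field k] [CharP k p] (X : Scheme.{0}) (f₀ : X ⟶ Spec (.of k))
    [IsSeparated f₀] [LocallyOfFiniteType f₀] [QuasiCompact f₀] [IsIntegral X] {n : ℕ} (hn : topologicalKrullDim X = n) (h3 : 3 ≤ n)
    (hXfull : ∀ x : X, FullCl p (X.presheaf.stalk x))
    (hR : ∀ e j : ℕ, 4 ≤ e → e + 1 ≤ n → 1 ≤ j → ClosedPointLocalResolutionFullTr p e j) :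
    ∀ ζ : X, ¬ IsClosed ({ζ} : Set X) →
      (∀ (S' : Scheme.{0}) (g : S' ⟶ Spec (X.presheaf.stalk ζ)) (I : (Spec (X.presheaf.stalk ζ)).IdealSheafData),
        IsBlowup g I → ((I.support : Set _) ⊆ (Scheme.regularLocus (Spec (X.presheaf.stalk ζ)))ᶜ) →
          (∀ s : S', s ∉ Scheme.regularLocus S' → g.base s = closedPoint (X.presheaf.stalk ζ)) →
          Scheme.AdmitsDesingularization S') ∨
      (∃ x : X, ζ ⤳ x ∧ ∀ (S' : Scheme.{0}) (g : S' ⟶ Spec (X.presheaf.stalk x)) (I : (Spec (X.presheaf.stalk x)).IdealSheafData),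
        IsBlowup g I → ((I.support : Set _) ⊆ (Scheme.regularLocus (Spec (X.presheaf.stalk x)))ᶜ) →
          Scheme.AdmitsDesingularization S') := by
  intro ζ hζ
  haveI : IsLocallyNoetherian X := LocallyOfFiniteType.isLocallyNoetherian f₀
  obtain ⟨m, hm⟩ := exists_nat_cast_eq_ringKrullDim (R := X.presheaf.stalk ζ)
  by_cases hm3 : m ≤ 3
  · obtain ⟨x, hζx, hx3⟩ := RegularOffCodimFourResidue.exists_specializes_ringKrullDim_stalk_eq f₀ hn ζ (n := 3)
      (by rw [hm]; exact_mod_cast hm3) h3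
    exact Or.inr ⟨x, hζx, fun S' g I hg _ => LocalBlowupDesingularizationDimThree.localBlowups_hloc hG h081R hP f₀ x hx3 S' g I hg⟩
  · obtain ⟨e, he, hed⟩ := ClosedPointLocalResolutionAdm.ringKrullDim_stalk_add_one_le_of_not_isClosed f₀ hn ζ hζ
    have hme : m = e := by
      have : (m : WithBot ℕ∞) = e := by rw [← hm]; exact he
      exact_mod_cast this
    exact Or.inl (localBody_at_nonClosed_of_trFull p f₀ ζ hζ (hXfull ζ) he fun j hj => hR e j (by omega) hed hj)

/-! ## §3 `ResolutionFullTr` from T_FULL: Temkin's induction on the FULL variety -/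

/-- ★★ **`ResolutionFullTr p e r` ⟸ `T_FULL(p,e′,j)` at the levels `4 ≤ e′ < e` (`j ≥ 1`) and `T_FULL(p,e,r)` itself**, modulo {CP 1.1, 081R, CP 4.4} (`e ≥ 4`): for ONE FULL
integral separated finite-type `e`-fold `Y` over `K = k(X₁,…,X_r)`, THEOREM A-adm (`DesingularizationOffClosedPointsAdm`, non-closed points, §2) gives a `Sing Y`-supported
blowing up regular off finitely many closed points, and `ResolutionOfTr.admitsDesingularization_of_regularOffFinite_of_localRes` finishes with `T_FULL(p,e,r)` at the closed
points of `Y` — whose germs are FULL. No patching, no alternation with the F-half. [OURS · conditional-result] [cite: Temkin2008, Prop. 2.3.4]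
[cite: CossartPiltant2019, Thm. 1.1 (i)(ii); Prop. 4.4] [cite: RaynaudGruson1971, Thm. 5.2.2] -/
theorem resolutionFullTr_of_trFull {p e r : ℕ} (h4 : 4 ≤ e)
    (hG : CossartPiltant2019General.{0}) (h081R : Stacks081R.{0}) (hP : CossartPiltant2019Principalization.{0})
    (hTFlt : ∀ e' j : ℕ, 4 ≤ e' → e' + 1 ≤ e → 1 ≤ j → ClosedPointLocalResolutionFullTr p e' j)
    (hTF : ClosedPointLocalResolutionFullTr p e r) : ResolutionFullTr p e r := by
  classical
  intro k _ _ Y g hs hl hq hi hd hYfull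
  haveI := hs; haveI := hl; haveI := hq
  haveI := NonClosedPointChart.charP_fractionRing_mvPolynomial p k r
  have hk : Scheme.IsQuasiExcellent (Spec (.of (FractionRing (MvPolynomial (Fin r) k)))) :=
    Scheme.isQuasiExcellent_of_locallyOfFiniteType Stacks07QW_field_holds (𝟙 _)
  haveI : IsNoetherianRing (CommRingCat.of (FractionRing (MvPolynomial (Fin r) k))) :=
    inferInstanceAs (IsNoetherianRing (FractionRing (MvPolynomial (Fin r) k)))
  obtain ⟨X', f, J, F, hf, hJ, -, hFfin, hFcl, hreg⟩ :=
    DesingularizationOffClosedPointsAdm.desingularization_offFinite_of_local_adm hk g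
      (hlocAdm_of_cp_of_trFull hG h081R hP p _ Y g hd (by omega) hYfull hTFlt)
  refine admitsDesingularization_of_regularOffFinite_of_localRes Y g (fun b hb _ S' g' I hg' hI hfib => ?_) X' f J hf hJ hFfin.toFinset
    (fun b hb => hFcl b (hFfin.mem_toFinset.mp hb)) (fun x' hx' => hreg x' fun h => hx' (hFfin.mem_toFinset.mpr h))
  exact hTF k Y g hs hl hq hi hd b hb (hYfull b) S' g' I hg' hI hfib

/-- **All levels `4 ≤ e ≤ n`, all `r ≥ 1`: `ResolutionFullTr` from T_FULL.** [OURS · conditional-result] [cite: Temkin2008, Prop. 2.3.4] -/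
theorem resolutionFullTr_le_of_trFull (p n : ℕ)
    (hG : CossartPiltant2019General.{0}) (h081R : Stacks081R.{0}) (hP : CossartPiltant2019Principalization.{0})
    (hTF : ∀ e r : ℕ, 4 ≤ e → e ≤ n → 1 ≤ r → ClosedPointLocalResolutionFullTr p e r) :
    ∀ e r : ℕ, 4 ≤ e → e ≤ n → 1 ≤ r → ResolutionFullTr p e r :=
  fun e r he hen _ => resolutionFullTr_of_trFull he hG h081R hP (fun e' j h4' hlt hj => hTF e' j h4' (by omega) hj) (hTF e r he hen (by omega))

/-! ## §4 The door terms and the equivalence web -/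

/-- ★★ **T(p,e,r) back from T_FULL(≤ e), the F-half at the levels `4 … e` and the four prints** — closing the web {T} ⟸ {ResolutionTr} ⟸ {FullBlowupTr ∧ ResolutionFullTr}
⟸ {T_FULL} ⟸ {T} level by level. [OURS · conditional-result] [cite: Temkin2008, Prop. 2.3.4; Lemma 2.1.4] [cite: CossartPiltant2019, Thm. 1.1; Prop. 4.4] [cite: Cesnavicius2021, Thm. 5.3] -/
theorem tr_le_of_prints_of_F_of_trFull (n : ℕ)
    (hG : CossartPiltant2019General.{0}) (h081R : Stacks081R.{0}) (hP : CossartPiltant2019Principalization.{0})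
    (hM : CesnaviciusBlowupMacaulayficationOffClosed.{0}) {p : ℕ} (hp : p.Prime)
    (hF : ∀ e : ℕ, 4 ≤ e → e ≤ n → ∀ (k : Type) [Field k] [CharP k p] (X : Scheme.{0}) (f : X ⟶ Spec (.of k)),
      IsSeparated f → LocallyOfFiniteType f → QuasiCompact f → IsIntegral X →
      ∀ x : X, IsClosed ({x} : Set X) → x ∉ Scheme.regularLocus X → ringKrullDim (X.presheaf.stalk x) = e →
      ∀ (S' : Scheme.{0}) (g : S' ⟶ Spec (X.presheaf.stalk x)) (I : (Spec (X.presheaf.stalk x)).IdealSheafData),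
        I ≠ ⊥ → (I.support : Set (Spec (X.presheaf.stalk x))) ⊆ (Scheme.regularLocus (Spec (X.presheaf.stalk x)))ᶜ → IsBlowup g I →
        (∀ s : S', g.base s ≠ closedPoint (X.presheaf.stalk x) → s ∈ Scheme.regularLocus S') →
        (∀ s : S', CMCl (S'.presheaf.stalk s)) →
        ∃ 𝓚 : S'.IdealSheafData, 𝓚 ≠ ⊥ ∧ (∀ s ∈ (𝓚.support : Set S'), g.base s = closedPoint (X.presheaf.stalk x)) ∧
          ∀ (S'' : Scheme.{0}) (π : S'' ⟶ S'), IsBlowup π 𝓚 → ∀ s : S'', FullCl p (S''.presheaf.stalk s))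
    (hTF : ∀ e r : ℕ, 4 ≤ e → e ≤ n → 1 ≤ r → ClosedPointLocalResolutionFullTr p e r) :
    ∀ e r : ℕ, 4 ≤ e → e ≤ n → 1 ≤ r → ClosedPointLocalResolutionAdmTr p e r :=
  tr_le_of_cesnaviciusOffClosed_of_F_of_resolutionFull n hG h081R hP hM hp hF (resolutionFullTr_le_of_trFull p n hG h081R hP hTF)

/-- ★★★ **THE ROUTE DECL ⟸ {CP 2019 Thm 1.1, Stacks 081R, CP 2019 Prop 4.4, Česnavičius 2021 Thm 5.3 (B)} BY NAME ∧ the F-half `LocalFInjectivizationFibreAdmGe4` ∧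
{T_FULL(p,e,r)}_{p prime, e ≥ 4, r ≥ 1}** — door v38's `_proof` shape with the resolution stub replaced by its LOCAL-FULL form. [OURS · conditional-result: conditional on four
published theorems BY NAME and on the CANDIDATE statements] [cite: Cesnavicius2021, Thm. 5.3] [cite: CossartPiltant2019, Thm. 1.1 (i)(ii); Prop. 4.4] [cite: Temkin2008, Prop. 2.3.4] -/
theorem fInjectiveMacaulayfication_of_prints_of_LFadmF_of_trFull
    (hG : CossartPiltant2019General.{0}) (h081R : Stacks081R.{0}) (hP : CossartPiltant2019Principalization.{0})
    (hM : CesnaviciusBlowupMacaulayficationOffClosed.{0})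
    (hLF : LocalFullificationFibreAdmGe4Split.LocalFInjectivizationFibreAdmGe4)
    (hTF : ∀ p e r : ℕ, p.Prime → 4 ≤ e → 1 ≤ r → ClosedPointLocalResolutionFullTr p e r) :
    Summit.ResolutionOfSingularities.ResolutionOfSingularities.Theses.FrobeniusLadder.FInjectiveMacaulayfication :=
  fInjectiveMacaulayfication_of_cesnaviciusOffClosed_of_LFadmF_of_resolutionFull hG h081R hP hM hLF fun p e r hp he hr =>
    resolutionFullTr_of_trFull he hG h081R hP (fun e' j h4' _ hj => hTF p e' j hp h4' hj) (hTF p e r hp he hr)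

/-- ★★★ **The same at ONE transcendental: crux ⟸ four prints ∧ F-half ∧ {T_FULL(p,e,1)}_{p prime, e ≥ 4}** — «at a CLOSED point with F-injective Cohen–Macaulay (FULL)
local ring of an e-fold over k(s), e ≥ 4, every admissible blowing up of the germ regular off the closed fibre admits a desingularization». [OURS · conditional-result]
[cite: Cesnavicius2021, Thm. 5.3] [cite: CossartPiltant2019, Thm. 1.1 (i)(ii); Prop. 4.4] [cite: Temkin2008, Prop. 2.3.4] -/
theorem fInjectiveMacaulayfication_of_prints_of_LFadmF_of_trFullOne
    (hG : CossartPiltant2019General.{0}) (h081R : Stacks081R.{0}) (hP : CossartPiltant2019Principalization.{0})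
    (hM : CesnaviciusBlowupMacaulayficationOffClosed.{0})
    (hLF : LocalFullificationFibreAdmGe4Split.LocalFInjectivizationFibreAdmGe4)
    (hTF1 : ∀ p e : ℕ, p.Prime → 4 ≤ e → ClosedPointLocalResolutionFullTr p e 1) :
    Summit.ResolutionOfSingularities.ResolutionOfSingularities.Theses.FrobeniusLadder.FInjectiveMacaulayfication :=
  fInjectiveMacaulayfication_of_prints_of_LFadmF_of_trFull hG h081R hP hM hLF fun p e r hp he hr => forall_trFull_of_one (hTF1 p e hp he) r hr

/-! ## §5 (appended 2026-08-28, res-L1-w45a-stub-3 g9, O7) The per-dimension slice at `d = 5` with the local-FULL rung -/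

/-- ★ **dim ≤ 5 ⟸ four published theorems ∧ F(4) ∧ F(5) ∧ T_FULL(p,4,1)** — on 5-folds the only resolution input of the local-FULL door is «at a CLOSED point with FULL local
ring of a 4-fold over k(s), every admissible blowing up of the germ whose singular points lie on the closed fibre admits a desingularization» (one line over
`TrOfResolutionFull.fInjectiveMacaulayfication_dimLe5_of_cesnaviciusOffClosed_of_resolutionFull41_of_F45` and §3 at `e = 4`, where no lower level is consumed).
[OURS · conditional-result] [cite: Cesnavicius2021, Thm. 5.3] [cite: CossartPiltant2019, Thm. 1.1 (i)(ii); Prop. 4.4] [cite: Temkin2008, Prop. 2.3.4] -/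
theorem fInjectiveMacaulayfication_dimLe5_of_cesnaviciusOffClosed_of_trFull41_of_F45
    (hG : CossartPiltant2019General.{0}) (h081R : Stacks081R.{0}) (hP : CossartPiltant2019Principalization.{0})
    (hM : CesnaviciusBlowupMacaulayficationOffClosed.{0})
    (hTF41 : ∀ p : ℕ, p.Prime → ClosedPointLocalResolutionFullTr p 4 1)
    (hF4 : ∀ (p : ℕ), p.Prime → ∀ (k : Type) [Field k] [CharP k p]
    (X : Scheme.{0}) (f : X ⟶ Spec (.of k)),
      IsSeparated f → LocallyOfFiniteType f → QuasiCompact f → IsIntegral X →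
      ∀ x : X, IsClosed ({x} : Set X) → x ∉ Scheme.regularLocus X → ringKrullDim (X.presheaf.stalk x) = 4 →
      ∀ (S' : Scheme.{0}) (g : S' ⟶ Spec (X.presheaf.stalk x)) (I : (Spec (X.presheaf.stalk x)).IdealSheafData),
        I ≠ ⊥ → (I.support : Set (Spec (X.presheaf.stalk x))) ⊆ (Scheme.regularLocus (Spec (X.presheaf.stalk x)))ᶜ → IsBlowup g I →
        (∀ s : S', g.base s ≠ closedPoint (X.presheaf.stalk x) → s ∈ Scheme.regularLocus S') →
        (∀ s : S', CMCl (S'.presheaf.stalk s)) →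
        ∃ 𝓚 : S'.IdealSheafData, 𝓚 ≠ ⊥ ∧ (∀ s ∈ (𝓚.support : Set S'), g.base s = closedPoint (X.presheaf.stalk x)) ∧
          ∀ (S'' : Scheme.{0}) (π : S'' ⟶ S'), IsBlowup π 𝓚 → ∀ s : S'', FullCl p (S''.presheaf.stalk s))
    (hF5 : ∀ (p : ℕ), p.Prime → ∀ (k : Type) [Field k] [CharP k p]
    (X : Scheme.{0}) (f : X ⟶ Spec (.of k)),
      IsSeparated f → LocallyOfFiniteType f → QuasiCompact f → IsIntegral X →
      ∀ x : X, IsClosed ({x} : Set X) → x ∉ Scheme.regularLocus X → ringKrullDim (X.presheaf.stalk x) = 5 →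
      ∀ (S' : Scheme.{0}) (g : S' ⟶ Spec (X.presheaf.stalk x)) (I : (Spec (X.presheaf.stalk x)).IdealSheafData),
        I ≠ ⊥ → (I.support : Set (Spec (X.presheaf.stalk x))) ⊆ (Scheme.regularLocus (Spec (X.presheaf.stalk x)))ᶜ → IsBlowup g I →
        (∀ s : S', g.base s ≠ closedPoint (X.presheaf.stalk x) → s ∈ Scheme.regularLocus S') →
        (∀ s : S', CMCl (S'.presheaf.stalk s)) →
        ∃ 𝓚 : S'.IdealSheafData, 𝓚 ≠ ⊥ ∧ (∀ s ∈ (𝓚.support : Set S'), g.base s = closedPoint (X.presheaf.stalk x)) ∧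
          ∀ (S'' : Scheme.{0}) (π : S'' ⟶ S'), IsBlowup π 𝓚 → ∀ s : S'', FullCl p (S''.presheaf.stalk s)) :
    ∀ p : ℕ, p.Prime → ∀ (k : Type) [Field k] [CharP k p] (X : Scheme.{0}) (f : X ⟶ Spec (.of k)),
      IsSeparated f → LocallyOfFiniteType f → QuasiCompact f → IsReduced X → topologicalKrullDim X ≤ 5 →
      ∃ (X' : Scheme.{0}) (π : X' ⟶ X), IsProper π ∧ IsBirational π ∧ ∀ x : X',
        IsDomain (X'.presheaf.stalk x) ∧ ∀ d : ℕ, ringKrullDim (X'.presheaf.stalk x) = d →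
          ∀ s : Fin d → X'.presheaf.stalk x, (Ideal.span (Set.range s)).radical.IsMaximal →
            RingTheory.Sequence.IsWeaklyRegular (X'.presheaf.stalk x) (List.ofFn s) ∧
            ∀ y : X'.presheaf.stalk x, (∃ e : ℕ, y ^ p ^ e ∈ Ideal.span
              ((fun z : X'.presheaf.stalk x => z ^ p ^ e) ''
                (Ideal.span (Set.range s) : Set (X'.presheaf.stalk x)))) →
              y ∈ Ideal.span (Set.range s) :=
  fInjectiveMacaulayfication_dimLe5_of_cesnaviciusOffClosed_of_resolutionFull41_of_F45 hG h081R hP hM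
    (fun p hp => resolutionFullTr_of_trFull le_rfl hG h081R hP (fun e' j h4' hlt _ => absurd hlt (by omega)) (hTF41 p hp)) hF4 hF5

end Summit.ResolutionOfSingularities.ResolutionOfSingularities.Theorems.FInjectiveMacaulayfication.TrFull

end
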